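import Literature.NumberTheory.Rogawski1990.Ch12Sec7CharacterInputs        -- ★ p850727 (F-b) the NAMED FACT `normalizedCharacter_locallyBounded` [HarishChandra1999AdmissibleDistributions Thm. 16.3; Rogawski1990 §1.6 p. 5]
import Literature.NumberTheory.Rogawski1990.Ch12Sec5Inputs                 -- ★ TR carpet: the (S-𝔇) socket (L2D∀) `EllipticData.L2CharOnTorusAll` (and (M1) `CharRegularity`)
import Literature.NumberTheory.Rogawski1990.CMLocalAPacketMembers          -- ★ `Gqs` (`U(Φ₃)(L⁺_v)`), `qsForm`
import Literature.NumberTheory.Automorphic.LocalUnitaryGroupCongr          -- ★ `antidiagOne_isHermitian`, `isUnit_antidiagOne_det` (the antecedents of (F-b) at `Φ₃`)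
import HarnessLib

/-!
# F0 · P3c · line LH6 «StCharTS» — «L2D-OF-HCB★» (datum road S9c, hypothesis form): the socket (L2D∀) `L2CharOnTorusAll` — «`D_G·χ_π ∈ L²(T, dγ)` on every
# ELLIPTIC Cartan representative, for every class `π`» — from Harish-Chandra's local boundedness (F-b) + (M1∀) at any datum whose elliptic representatives are
# COMPACT of FINITE mass and whose `D_G` is (bounded by) print's `|D_G|^{1/2}` [Rogawski1990, §12.5 p. 184; L. 12.7.2 proof p. 193; §1.6 p. 5]

Cell `pub/hodgecm-mathlib`, crux H413 = `stmt-HodgeConjecture-24833` (lane `--supports … --as helper`), route HCCMUnconditional; seat LH6-p02 (g4); slice S9c of the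
(S-𝔇) DATUM ROAD (map owner LH6-p01 (g4), `F0/P3b/LH6-p01/g4/MAP-DATUM-ROAD.v2.LH6p01g4.md`, PLAN `…/PLAN-S9-CartanWeylMeasures.v1.LH6p01g4.md` §2 «S9c L2D-OF-HCB»).
THEOREMS ONLY (no definition ∕ instance ∕ notation ∕ named fact ∕ `sorry`); ★-only imports.
HONEST LABEL: HC_CM is proved only modulo the 7 printed citations (2 remaining named inputs: hLiu418 = `stmt-HodgeConjecture-24832`, h413 = `stmt-HodgeConjecture-24833`)
until rung 0 closes; this file closes no organ — at the future concrete datum the socket (L2D∀) (leaf ED. 17: its elliptic form (L2D-ell)) becomes a theorem MODULO the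
named fact (F-b) ★ `normalizedCharacter_locallyBounded` (already a binder of the leaf since ED. 14) — count-neutral.

THE MATHEMATICS ([Rogawski1990, L. 12.7.2 proof p. 193]: «By [H₁], `D_G χ_π` is bounded on the elliptic set»; §12.5 p. 184: the elliptic Cartan subgroups are compact
modulo the (compact) centre and `meas(Z∖T) = 1`).  Let `𝔇` be a §12.5 datum on `G = U(Φ₃)(L⁺_v)` with `𝔇.μG = νQv` (Haar), `𝔇.regG = G^{reg}` (COMPAT), and (M1∀): every
`χ_π = 𝔇.char π` is measurable, locally integrable, locally constant at the regular points and represents `Tr π` on `C_c^∞(G)`.  Harish-Chandra's Theorem 16.3 in the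
tree's typed form (F-b) gives, for every compact `C ⊆ G`, a bound `√√‖u‖ · |χ_π(g)| ≤ B` for `g ∈ C` and every unit `u` with `u·det(g)² = disc(charpoly g)` (`√√‖u‖ =
|D_G(g)|^{1/2}`, [§4.9 p. 54]).  SLICE HYPOTHESES on the Cartan data (PLAN S9 §1: D3 «elliptic = compact», D4 «mass one», D5 «`DG = √√‖disc∕det²‖`, `0` off `G^{reg}`»,
all `rfl`∕one-liners at the constructor): every `T ∈ cartanG` is COMPACT in `G`, `μT T` is FINITE, `𝔇.DG` is measurable, and at each `t ∈ T` either `𝔇.DG t = 0` or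
`|𝔇.DG t| ≤ √√‖u‖` for some unit `u` with the discriminant relation.  Then `|D_G(t)·χ_π(t)| ≤ max B 0` on `T`, so `D_G χ_π|_T` is a bounded measurable function on a
finite measure space, hence in `L²(T, dγ)` (Mathlib `MemLp.of_bound`) — for EVERY class `π`, elliptic or not.
* `l2CharOnTorusAll_of_hcBounded` — (L2D∀) ★ `EllipticData.L2CharOnTorusAll`;
* `l2dEll_of_hcBounded` — its elliptic form (L2D-ell) in the leaf's ED. 17 text (`∀ π, 𝔇.IsEllipticRep π → …`);
* `memLp_char_of_hcBound_on_compact` — the one-torus step.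

## References
* [Rogawski1990] J. D. Rogawski, *Automorphic Representations of Unitary Groups in Three Variables*, Ann. of Math. Stud. 123 (1990): §1.6 p. 5 ([H₁]); §4.9 p. 54 (`D_G`);
  §12.5 p. 184 (elliptic Cartan representatives, `meas(Z∖T) = 1`); §12.7 Lemma 12.7.2 (proof) p. 193 («`D_G χ_π` is bounded on the elliptic set»).
* [HarishChandra1999AdmissibleDistributions] Harish-Chandra, *Admissible invariant distributions on reductive p-adic groups* (notes by S. DeBacker, P. J. Sally),
  AMS ULS 16 (1999): Part III §16 Thm. 16.3.
-/

set_option autoImplicit false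
-- the mandated namespace has the single-problem summit's repeated segment (`HodgeConjecture.HodgeConjecture`)
set_option linter.dupNamespace false

noncomputable section

open MeasureTheory Filter Topology
open NumberField IsDedekindDomain
open scoped NNReal
open Literature.NumberTheory.Automorphic Literature.NumberTheory.Automorphic.UnitaryGroup Literature.NumberTheory.Rogawski1990

namespace Summit.HodgeConjecture.HodgeConjecture.Cruxes.H413.F0P3cStCharTSL2dOfHcb

variable (L : Type) [Field L] [NumberField L] [IsCMField L] (v : HeightOneSpectrum (𝓞 ↥(maximalRealSubfield L)))

/-! ## §1 One torus: a Harish-Chandra bound on a compact `T` of finite mass puts `D_G·Θ|_T` in `L²` -/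

/-- **One-torus step.**  `T ≤ U(Φ₃)(L⁺_v)` a subgroup, COMPACT as a subset, with a FINITE measure `μ` on `↥T`; `D : G → ℝ` and `Θ : G → ℂ` measurable; a bound `B` of
Harish-Chandra type on `T` («`√√‖u‖·‖Θ g‖ ≤ B` for `g ∈ T` and every unit `u` with `u·det(g)² = disc(charpoly g)`», the conclusion of (F-b) at `C = T`); and at every
`t ∈ T` either `D t = 0` or `|D t| ≤ √√‖u‖` for such a `u`.  Then `t ↦ D(t)·Θ(t)` is in `L²(T, μ)` (bounded by `max B 0`, Mathlib `MemLp.of_bound`).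
[cite: Rogawski1990, §12.7 Lemma 12.7.2 (proof) p. 193; §12.5 p. 184] -/
theorem memLp_mul_of_hcBound_on_subgroup
    [MeasurableSpace (Gqs L v)]
    (T : Subgroup (Gqs L v)) (μ : Measure ↥T) [IsFiniteMeasure μ]
    {D : Gqs L v → ℝ} (hDm : Measurable D) {Θ : Gqs L v → ℂ} (hΘm : Measurable Θ) {B : ℝ}
    (hB : ∀ g ∈ (T : Set (Gqs L v)), ∀ u : (UnitaryGroup.LocalRing L v)ˣ,
      (u : UnitaryGroup.LocalRing L v) * ((g.val : GL (Fin 3) (UnitaryGroup.LocalRing L v)).val.det) ^ (3 - 1) =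
          ((g.val : GL (Fin 3) (UnitaryGroup.LocalRing L v)).val.charpoly).discr →
        ((NNReal.sqrt (NNReal.sqrt (unitModulusChar (UnitaryGroup.LocalRing L v) u)) : ℝ≥0) : ℝ) * ‖Θ g‖ ≤ B)
    (hD : ∀ t : ↥T, D (t : Gqs L v) = 0 ∨ ∃ u : (UnitaryGroup.LocalRing L v)ˣ,
      (u : UnitaryGroup.LocalRing L v) * ((((t : Gqs L v)).val : GL (Fin 3) (UnitaryGroup.LocalRing L v)).val.det) ^ (3 - 1) =
          ((((t : Gqs L v)).val : GL (Fin 3) (UnitaryGroup.LocalRing L v)).val.charpoly).discr ∧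
        |D (t : Gqs L v)| ≤ ((NNReal.sqrt (NNReal.sqrt (unitModulusChar (UnitaryGroup.LocalRing L v) u)) : ℝ≥0) : ℝ)) :
    MemLp (fun t : ↥T => (D (t : Gqs L v) : ℂ) * Θ (t : Gqs L v)) 2 μ := by
  refine MemLp.of_bound ?_ (max B 0) (Eventually.of_forall fun t => ?_)
  · exact ((Complex.measurable_ofReal.comp (hDm.comp measurable_subtype_coe)).mul
      (hΘm.comp measurable_subtype_coe)).aestronglyMeasurable
  · rw [norm_mul, Complex.norm_real, Real.norm_eq_abs]
    rcases hD t with h0 | ⟨u, hu, hle⟩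
    · rw [h0, abs_zero, zero_mul]
      exact le_max_right _ _
    · calc |D (t : Gqs L v)| * ‖Θ (t : Gqs L v)‖
          ≤ ((NNReal.sqrt (NNReal.sqrt (unitModulusChar (UnitaryGroup.LocalRing L v) u)) : ℝ≥0) : ℝ) * ‖Θ (t : Gqs L v)‖ :=
            mul_le_mul_of_nonneg_right hle (norm_nonneg _)
        _ ≤ B := hB (t : Gqs L v) (SetLike.mem_coe.2 t.2) u hu
        _ ≤ max B 0 := le_max_left _ _

/-! ## §2 The slice: (L2D∀) at a datum with compact elliptic representatives of finite mass, from (F-b) + (M1∀) -/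

/-- **S9c «L2D-OF-HCB★» — the socket (L2D∀) ★ `EllipticData.L2CharOnTorusAll` from Harish-Chandra's local boundedness (F-b) + (M1∀).**  On `Gqs L v = U(Φ₃)(L⁺_v)` with a
Haar measure `νQv` (binder-supplied Borel structure): for every §12.5 datum `𝔇` with COMPAT `𝔇.μG = νQv`, `𝔇.regG ↔ IsRegularElt`, the (M1∀) socket of the leaf (ED. 17
text: for EVERY class, `𝔇.char π` measurable, locally integrable, locally constant on `G^{reg}`, representing the trace), and the SLICE HYPOTHESES on its Cartan data
(PLAN S9 D3∕D4∕D5): `𝔇.DG` measurable; every `T ∈ 𝔇.cartanG` compact in `G` with `𝔇.μT T` finite; at each `t ∈ T`, `𝔇.DG t = 0` or `|𝔇.DG t| ≤ √√‖u‖` for a unit `u` with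
`u·det(t)² = disc(charpoly t)` — GIVEN (F-b) `hHC : normalizedCharacter_locallyBounded`, (L2D∀) holds: `D_G·χ_π ∈ L²(T, dγ)` for every class `π` and every `T ∈ cartanG`.
[cite: Rogawski1990, §12.7 Lemma 12.7.2 (proof) p. 193; §12.5 p. 184; §1.6 p. 5; §4.9 p. 54] [cite: HarishChandra1999AdmissibleDistributions, Part III §16 Thm. 16.3] -/
theorem l2CharOnTorusAll_of_hcBounded (hHC : normalizedCharacter_locallyBounded)
    [MeasurableSpace (Gqs L v)] [BorelSpace (Gqs L v)]
    [∀ γ : Gqs L v, MeasurableSpace (Gqs L v ⧸ Subgroup.centralizer ({γ} : Set (Gqs L v)))] [MeasurableSpace (Gqs L v ⧸ Subgroup.center (Gqs L v))]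
    {H : Type} [Group H] [TopologicalSpace H] [IsTopologicalGroup H] [MeasurableSpace H]
    (νQv : Measure (Gqs L v)) [νQv.IsHaarMeasure]
    (𝔇 : Ch12Sec5.EllipticData (Gqs L v) H) (hμG : 𝔇.μG = νQv)
    (hreg : ∀ γ : Gqs L v, γ ∈ 𝔇.regG ↔ IsRegularElt (γ.val : GL (Fin 3) (UnitaryGroup.LocalRing L v)))
    (hM1 : ∀ π : IrrClass (Gqs L v), Measurable (𝔇.char π) ∧ LocallyIntegrable (𝔇.char π) 𝔇.μG ∧
      (∀ x ∈ 𝔇.regG, ∀ᶠ y in 𝓝 x, 𝔇.char π y = 𝔇.char π x) ∧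
      ∀ φ : Gqs L v → ℂ, IsLocSmooth φ → π.smoothTrace 𝔇.μG φ = ∫ x, φ x * 𝔇.char π x ∂𝔇.μG)
    (hDGm : Measurable 𝔇.DG)
    (hK : ∀ T ∈ 𝔇.cartanG, IsCompact (T : Set (Gqs L v)))
    (hF : ∀ T ∈ 𝔇.cartanG, IsFiniteMeasure (𝔇.μT T))
    (hDG : ∀ T ∈ 𝔇.cartanG, ∀ t : ↥T, 𝔇.DG (t : Gqs L v) = 0 ∨ ∃ u : (UnitaryGroup.LocalRing L v)ˣ,
      (u : UnitaryGroup.LocalRing L v) * ((((t : Gqs L v)).val : GL (Fin 3) (UnitaryGroup.LocalRing L v)).val.det) ^ (3 - 1) =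
          ((((t : Gqs L v)).val : GL (Fin 3) (UnitaryGroup.LocalRing L v)).val.charpoly).discr ∧
        |𝔇.DG (t : Gqs L v)| ≤ ((NNReal.sqrt (NNReal.sqrt (unitModulusChar (UnitaryGroup.LocalRing L v) u)) : ℝ≥0) : ℝ)) :
    𝔇.L2CharOnTorusAll := by
  intro π T hT
  obtain ⟨hm, hli, hlc, htr⟩ := hM1 π
  rw [hμG] at hli htr
  have hlc' : ∀ x : Gqs L v, IsRegularElt (x.val : GL (Fin 3) (UnitaryGroup.LocalRing L v)) → ∀ᶠ y in 𝓝 x, 𝔇.char π y = 𝔇.char π x :=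
    fun x hx => hlc x ((hreg x).2 hx)
  obtain ⟨B, hB⟩ := hHC L 3 (qsForm L) (antidiagOne_isHermitian L 3) (isUnit_antidiagOne_det L 3).ne_zero v νQv π (𝔇.char π)
    hli hlc' htr (T : Set (Gqs L v)) (hK T hT)
  haveI := hF T hT
  exact memLp_mul_of_hcBound_on_subgroup L v T (𝔇.μT T) hDGm hm hB (hDG T hT)

/-- **(L2D-ell) in the leaf's ED. 17 text** («… for every ELLIPTIC `π`») — the corollary of §2 the ED. pen can `exact` in the `hL2ell` slot once the constructor supplies the
slice hypotheses. [cite: Rogawski1990, §12.7 Lemma 12.7.2 (proof) p. 193; §12.5 p. 184] -/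
theorem l2dEll_of_hcBounded (hHC : normalizedCharacter_locallyBounded)
    [MeasurableSpace (Gqs L v)] [BorelSpace (Gqs L v)]
    [∀ γ : Gqs L v, MeasurableSpace (Gqs L v ⧸ Subgroup.centralizer ({γ} : Set (Gqs L v)))] [MeasurableSpace (Gqs L v ⧸ Subgroup.center (Gqs L v))]
    {H : Type} [Group H] [TopologicalSpace H] [IsTopologicalGroup H] [MeasurableSpace H]
    (νQv : Measure (Gqs L v)) [νQv.IsHaarMeasure]
    (𝔇 : Ch12Sec5.EllipticData (Gqs L v) H) (hμG : 𝔇.μG = νQv)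
    (hreg : ∀ γ : Gqs L v, γ ∈ 𝔇.regG ↔ IsRegularElt (γ.val : GL (Fin 3) (UnitaryGroup.LocalRing L v)))
    (hM1 : ∀ π : IrrClass (Gqs L v), Measurable (𝔇.char π) ∧ LocallyIntegrable (𝔇.char π) 𝔇.μG ∧
      (∀ x ∈ 𝔇.regG, ∀ᶠ y in 𝓝 x, 𝔇.char π y = 𝔇.char π x) ∧
      ∀ φ : Gqs L v → ℂ, IsLocSmooth φ → π.smoothTrace 𝔇.μG φ = ∫ x, φ x * 𝔇.char π x ∂𝔇.μG)
    (hDGm : Measurable 𝔇.DG)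
    (hK : ∀ T ∈ 𝔇.cartanG, IsCompact (T : Set (Gqs L v)))
    (hF : ∀ T ∈ 𝔇.cartanG, IsFiniteMeasure (𝔇.μT T))
    (hDG : ∀ T ∈ 𝔇.cartanG, ∀ t : ↥T, 𝔇.DG (t : Gqs L v) = 0 ∨ ∃ u : (UnitaryGroup.LocalRing L v)ˣ,
      (u : UnitaryGroup.LocalRing L v) * ((((t : Gqs L v)).val : GL (Fin 3) (UnitaryGroup.LocalRing L v)).val.det) ^ (3 - 1) =
          ((((t : Gqs L v)).val : GL (Fin 3) (UnitaryGroup.LocalRing L v)).val.charpoly).discr ∧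
        |𝔇.DG (t : Gqs L v)| ≤ ((NNReal.sqrt (NNReal.sqrt (unitModulusChar (UnitaryGroup.LocalRing L v) u)) : ℝ≥0) : ℝ)) :
    ∀ π : IrrClass (Gqs L v), 𝔇.IsEllipticRep π →
      ∀ T ∈ 𝔇.cartanG, MemLp (fun t : ↥T => (𝔇.DG (t : Gqs L v) : ℂ) * 𝔇.char π (t : Gqs L v)) 2 (𝔇.μT T) :=
  fun π _ => l2CharOnTorusAll_of_hcBounded L v hHC νQv 𝔇 hμG hreg hM1 hDGm hK hF hDG π

end Summit.HodgeConjecture.HodgeConjecture.Cruxes.H413.F0P3cStCharTSL2dOfHcb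

end
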